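import Mathlib
import HarnessLib
import Summits.NavierStokesRegularity.NavierStokesRegularity.Theses.HalfSpaceWindowDoor
import Summits.NavierStokesRegularity.NavierStokesRegularity.Theses.PoloidalWindowDoor
import Summits.NavierStokesRegularity.NavierStokesRegularity.Theorems.HalfSpaceWindowDoorHalfSpaceZoom
import Summits.NavierStokesRegularity.NavierStokesRegularity.Theorems.HalfSpaceWindowDoorCirculationCarryingRigidityOfLiouville
import Summits.NavierStokesRegularity.NavierStokesRegularity.Theorems.PoloidalWindowDoorOfLiouville

/-!
# Route `HalfSpaceWindowDoor`: the rung leaf `Target` (stmt-NavierStokesRegularity-25310) MODULO ITS TWO NAMED RESEARCH WALLS,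
# and under the KNSS Liouville conjecture (L) — CONDITIONAL results, by name; nothing is closed by this file

LEAD ns-hsw-p1 g14 (cell pub-ns-dss), recommendation (a) of the hand-back memo
`Cruxes/CirculationCarryingRigidity/Lines/birth_handback.md` made kernel-real.  Of the five items of the route, three are PROVED
(`HalfSpaceZoom` 25312 — `Theorems.halfSpaceWindowDoor_halfSpaceZoom_proof`; `Assembly` 25313; and the deciding theorem
`Theses.HalfSpaceWindowDoor.closes`), and of the crux `CirculationCarryingRigidity` (25311) everything but the research statement is
landed (`stub_rotate` p611557, `stub_windowedFluxDecay` p611556).  What remains are exactly two research-level hypotheses, both typed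
in the tree and both open in print:

* W6 := `…HalfSpaceWindowDoorCirculationCarryingRigidityDefs.HemisphereLiouvilleE3` («closed-hemisphere Type-I ancient Oseen-mild
  profiles are poloidal»; the Type-I case of Lei–Ren–Tian, arXiv:2501.08976, Remark 1.3), which gives the crux by `…Rotate.stub_rotate`;
* K3 := `Theses.PoloidalWindowDoor.PoloidalWindowRigidity` (item stmt-NavierStokesRegularity-19708 of the sister route, shared VERBATIM:
  `poloidalWindowRigidity_shared_iff` is `Iff.rfl`).

This file records, by name: `target_of_hemisphereLiouvilleE3 : W6 → K3 → Target` (the closed-hemisphere window door as a CONDITIONAL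
door on two named open hypotheses), `target_of_stubLayerExclusion` (the same with the registered stub text), and
`target_of_liouvilleConjectureNS : LiouvilleConjectureNS → Target` (the door holds under (L) alone, composing the two conditional
bridges `…OfLiouville.circulationCarryingRigidity_of_liouvilleConjectureNS` and `PoloidalWindowDoorOfLiouville.poloidalWindowRigidity_of_liouvilleConjectureNS`).

HONEST FRAMING: `conditional-result`s — the hypotheses W6, K3, (L) are OPEN; the door `Target` is a regularity CRITERION about a
HYPOTHETICAL locally-Type-I singular point, not a regularity theorem; nothing here proves or claims Navier–Stokes regularity (Clay A),
and no item is closed by this file.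
-/

noncomputable section

-- the summit and its single sub-problem share the name (CONVENTIONS §1), as in every Theorems file
set_option linter.dupNamespace false

namespace Summit.NavierStokesRegularity.NavierStokesRegularity.Theorems.HalfSpaceWindowDoorTargetConditional

open Summit.NavierStokesRegularity.NavierStokesRegularity (LiouvilleConjectureNS)
open Summit.NavierStokesRegularity.NavierStokesRegularity.Theses.HalfSpaceWindowDoor
open Summit.NavierStokesRegularity.NavierStokesRegularity.Theorems (halfSpaceWindowDoor_halfSpaceZoom_proof)
open Summit.NavierStokesRegularity.NavierStokesRegularity.Theorems.HalfSpaceWindowDoorCirculationCarryingRigidityDefs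
  (HemisphereLiouvilleE3 StubLayerExclusion)
open Summit.NavierStokesRegularity.NavierStokesRegularity.Theorems.HalfSpaceWindowDoorCirculationCarryingRigidityRotate (stub_rotate)
open Summit.NavierStokesRegularity.NavierStokesRegularity.Theorems.HalfSpaceWindowDoorCirculationCarryingRigidityReduction
  (circulationCarryingRigidity_of_stubLayerExclusion)
open Summit.NavierStokesRegularity.NavierStokesRegularity.Theorems.HalfSpaceWindowDoorCirculationCarryingRigidityOfLiouville
  (circulationCarryingRigidity_of_liouvilleConjectureNS)
open Summit.NavierStokesRegularity.NavierStokesRegularity.Theorems.PoloidalWindowDoorOfLiouville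
  (poloidalWindowRigidity_of_liouvilleConjectureNS)

/-- **The shared crux is literally shared.**  Item stmt-NavierStokesRegularity-19708 is filed VERBATIM in both route files; the two
declarations `Theses.HalfSpaceWindowDoor.PoloidalWindowRigidity` and `Theses.PoloidalWindowDoor.PoloidalWindowRigidity` have the same
definiens, so a proof of either is a proof of the other (`Iff.rfl`). -/
theorem poloidalWindowRigidity_shared_iff :
    Summit.NavierStokesRegularity.NavierStokesRegularity.Theses.HalfSpaceWindowDoor.PoloidalWindowRigidity ↔
      Summit.NavierStokesRegularity.NavierStokesRegularity.Theses.PoloidalWindowDoor.PoloidalWindowRigidity :=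
  Iff.rfl

/-- **The closed-hemisphere window door as a CONDITIONAL door on its two named research walls** (conditional result):
`HemisphereLiouvilleE3 → PoloidalWindowRigidity (19708) → Target`.  Proof: the route's deciding theorem `closes` with the crux
`CirculationCarryingRigidity` supplied by W6 through the landed plumbing stub `stub_rotate`, the shared crux K3 as hypothesis, and the
PROVED zoom support `halfSpaceWindowDoor_halfSpaceZoom_proof`. -/
theorem target_of_hemisphereLiouvilleE3 (hW6 : HemisphereLiouvilleE3)
    (hK3 : Summit.NavierStokesRegularity.NavierStokesRegularity.Theses.PoloidalWindowDoor.PoloidalWindowRigidity) : Target :=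
  closes (stub_rotate hW6) (poloidalWindowRigidity_shared_iff.2 hK3) halfSpaceWindowDoor_halfSpaceZoom_proof

/-- **The same with the registered stub text** (conditional result): the open stub `StubLayerExclusion` of the crux skeleton of record
(sha b0f8cfc0; `StubLayerExclusion ↔ HemisphereLiouvilleE3` is `…Reduction.stubLayerExclusion_iff_hemisphereLiouvilleE3`) and the shared
crux K3 give the door. -/
theorem target_of_stubLayerExclusion (hStub : StubLayerExclusion)
    (hK3 : Summit.NavierStokesRegularity.NavierStokesRegularity.Theses.PoloidalWindowDoor.PoloidalWindowRigidity) : Target :=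
  closes (circulationCarryingRigidity_of_stubLayerExclusion hStub) (poloidalWindowRigidity_shared_iff.2 hK3)
    halfSpaceWindowDoor_halfSpaceZoom_proof

/-- **The closed-hemisphere window door holds under the KNSS Liouville conjecture (L) alone** (conditional result; ladder placement of
the whole route): both research walls sit below (L) — `circulationCarryingRigidity_of_liouvilleConjectureNS` (this route) and
`poloidalWindowRigidity_of_liouvilleConjectureNS` (sister route, same statement) — and the zoom support is proved. -/
theorem target_of_liouvilleConjectureNS (hL : LiouvilleConjectureNS) : Target :=
  closes (circulationCarryingRigidity_of_liouvilleConjectureNS hL)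
    (poloidalWindowRigidity_shared_iff.2 (poloidalWindowRigidity_of_liouvilleConjectureNS hL))
    halfSpaceWindowDoor_halfSpaceZoom_proof

end Summit.NavierStokesRegularity.NavierStokesRegularity.Theorems.HalfSpaceWindowDoorTargetConditional

end
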